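import Mathlib
import Summits.NavierStokesRegularity.NavierStokesRegularity.Theorems.FilamentSkeletonRssStadiumDeviationPackage

/-!
# Route `FilamentSkeletonRss` · child crux `TangentSkeletonNearStraightL` (stmt-NavierStokesRegularity-23320) · registered line
# `child_tangent_analytic_strip_L` (b0b56c52900dd90a), stub `stub_stripPropagation` — brick: THE CHORD PROJECTION OF A NEAR-STRAIGHT FILAMENT

The `c₀`-input of the foot estimate (`Theorems.StadiumFootTangential.re_chord_sq_ge_of_feet`,
`Theorems.StadiumFootClosedForm.foot_re_ge_closed_form`): for a `C¹` unit-speed filament `X` with tangent oscillation `‖X′(τ) − X′(σ)‖ ≤ Rb`,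
the chord projects on the tangent at one foot with `⟪X(x₂) − X(x₁), X′(x₁)⟫ ≥ (1 − Rb²/2)·(x₂ − x₁)` (`x₁ ≤ x₂`), because
`⟪X′(s), X′(x₁)⟫ = 1 − ‖X′(s) − X′(x₁)‖²/2 ≥ 1 − Rb²/2` for unit vectors (`inner_unit_ge`); `chord_proj_ge` is the inner-product form and
`chord_proj_coords_ge` the coordinate form `Σᵢ (⟪X x₂,eᵢ⟫ − ⟪X x₁,eᵢ⟫)·⟪X′ x₁,eᵢ⟫` used by the foot estimate.
HONEST FRAMING: elementary geometry for a plan about a HYPOTHETICAL filament skeleton on the NEGATIVE side of a MODEL route; the stub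
`stub_stripPropagation` is NOT closed by this file; nothing here bears on Navier–Stokes regularity or blow-up.  `--supports stmt-NavierStokesRegularity-23320`.
-/

set_option linter.dupNamespace false

noncomputable section

namespace Summit.NavierStokesRegularity.NavierStokesRegularity.Theorems.StadiumChordProjection

open Set MeasureTheory
open scoped InnerProductSpace BigOperators
open Summit.NavierStokesRegularity.NavierStokesRegularity.Theorems.StadiumDeviationPackage

/-- **Unit vectors at distance `≤ Rb` have inner product `≥ 1 − Rb²/2`.** [folklore] -/
theorem inner_unit_ge {u v : EuclideanSpace ℝ (Fin 3)} (hu : ‖u‖ = 1) (hv : ‖v‖ = 1) {Rb : ℝ} (h : ‖u - v‖ ≤ Rb) :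
    1 - Rb ^ 2 / 2 ≤ ⟪u, v⟫_ℝ := by
  have h1 : ‖u - v‖ ^ 2 = ‖u‖ ^ 2 - 2 * ⟪u, v⟫_ℝ + ‖v‖ ^ 2 := norm_sub_sq_real u v
  rw [hu, hv] at h1
  have h2 : ‖u - v‖ ^ 2 ≤ Rb ^ 2 := pow_le_pow_left₀ (norm_nonneg _) h 2
  nlinarith

/-- **Chord projection of a near-straight unit-speed filament.**  `X` continuously differentiable with `‖X′‖ = 1` and
`‖X′(τ) − X′(σ)‖ ≤ Rb`; then for `x₁ ≤ x₂`: `(1 − Rb²/2)(x₂ − x₁) ≤ ⟪X(x₂) − X(x₁), X′(x₁)⟫`. [folklore] -/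
theorem chord_proj_ge {X : ℝ → EuclideanSpace ℝ (Fin 3)} (hX : ContDiff ℝ 1 X) (hXu : ∀ τ, ‖deriv X τ‖ = 1)
    {Rb : ℝ} (hosc : ∀ τ σ, ‖deriv X τ - deriv X σ‖ ≤ Rb) {x₁ x₂ : ℝ} (hx : x₁ ≤ x₂) :
    (1 - Rb ^ 2 / 2) * (x₂ - x₁) ≤ ⟪X x₂ - X x₁, deriv X x₁⟫_ℝ := by
  have hXd : Differentiable ℝ X := hX.differentiable (by norm_num)
  have hXc : Continuous (deriv X) := hX.continuous_deriv le_rfl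
  -- the scalar function `g(s) = ⟪X s, X′ x₁⟫` and its derivative
  set w : EuclideanSpace ℝ (Fin 3) := deriv X x₁ with hw
  have hg : ∀ s, HasDerivAt (fun s => ⟪X s, w⟫_ℝ) (⟪deriv X s, w⟫_ℝ) s := by
    intro s
    have h1 : HasDerivAt X (deriv X s) s := (hXd s).hasDerivAt
    have h2 := h1.inner ℝ (hasDerivAt_const s w)
    simpa using h2
  have hcont : Continuous fun s => ⟪deriv X s, w⟫_ℝ := hXc.inner continuous_const
  have hftc : ∫ s in x₁..x₂, ⟪deriv X s, w⟫_ℝ = ⟪X x₂, w⟫_ℝ - ⟪X x₁, w⟫_ℝ :=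
    intervalIntegral.integral_eq_sub_of_hasDerivAt (fun s _ => hg s) (hcont.intervalIntegrable _ _)
  have hlow : ∀ s, 1 - Rb ^ 2 / 2 ≤ ⟪deriv X s, w⟫_ℝ := fun s => inner_unit_ge (hXu s) (hXu x₁) (hosc s x₁)
  have hmono := intervalIntegral.integral_mono_on (μ := volume) hx (intervalIntegrable_const (c := 1 - Rb ^ 2 / 2))
    (hcont.intervalIntegrable _ _) (fun s _ => hlow s)
  rw [intervalIntegral.integral_const, smul_eq_mul, hftc] at hmono
  rw [inner_sub_left]
  linarith

/-- **Coordinate form** (the `c₀`-hypothesis of the foot estimate): `(1 − Rb²/2)(x₂ − x₁) ≤ Σᵢ (⟪X x₂,eᵢ⟫ − ⟪X x₁,eᵢ⟫)·⟪X′ x₁,eᵢ⟫`. [folklore] -/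
theorem chord_proj_coords_ge {X : ℝ → EuclideanSpace ℝ (Fin 3)} (hX : ContDiff ℝ 1 X) (hXu : ∀ τ, ‖deriv X τ‖ = 1)
    {Rb : ℝ} (hosc : ∀ τ σ, ‖deriv X τ - deriv X σ‖ ≤ Rb) {x₁ x₂ : ℝ} (hx : x₁ ≤ x₂) :
    (1 - Rb ^ 2 / 2) * (x₂ - x₁) ≤ ∑ i, (⟪X x₂, EuclideanSpace.single i (1:ℝ)⟫_ℝ - ⟪X x₁, EuclideanSpace.single i (1:ℝ)⟫_ℝ) *
      ⟪deriv X x₁, EuclideanSpace.single i (1:ℝ)⟫_ℝ := by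
  have h := chord_proj_ge hX hXu hosc hx
  have hco : ⟪X x₂ - X x₁, deriv X x₁⟫_ℝ = ∑ i, (⟪X x₂, EuclideanSpace.single i (1:ℝ)⟫_ℝ - ⟪X x₁, EuclideanSpace.single i (1:ℝ)⟫_ℝ) *
      ⟪deriv X x₁, EuclideanSpace.single i (1:ℝ)⟫_ℝ := by
    simp only [inner_single_eq]
    rw [PiLp.inner_apply]
    refine Finset.sum_congr rfl fun i _ => ?_
    simp [mul_comm]
  rw [← hco]
  exact h

/-- The same with the roles of the feet exchanged (`x₂ ≤ x₁`), inner-product form: `(1 − Rb²/2)(x₁ − x₂) ≤ ⟪X(x₁) − X(x₂), X′(x₁)⟫` —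
projection on the tangent at the TARGET foot `x₁` when the source lies on the other side. [folklore] -/
theorem chord_proj_ge' {X : ℝ → EuclideanSpace ℝ (Fin 3)} (hX : ContDiff ℝ 1 X) (hXu : ∀ τ, ‖deriv X τ‖ = 1)
    {Rb : ℝ} (hosc : ∀ τ σ, ‖deriv X τ - deriv X σ‖ ≤ Rb) {x₁ x₂ : ℝ} (hx : x₂ ≤ x₁) :
    (1 - Rb ^ 2 / 2) * (x₁ - x₂) ≤ ⟪X x₁ - X x₂, deriv X x₁⟫_ℝ := by
  have hXd : Differentiable ℝ X := hX.differentiable (by norm_num)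
  have hXc : Continuous (deriv X) := hX.continuous_deriv le_rfl
  have hg : ∀ s, HasDerivAt (fun s => ⟪X s, deriv X x₁⟫_ℝ) (⟪deriv X s, deriv X x₁⟫_ℝ) s := by
    intro s
    have h1 : HasDerivAt X (deriv X s) s := (hXd s).hasDerivAt
    have h2 := h1.inner ℝ (hasDerivAt_const s (deriv X x₁))
    simpa using h2
  have hcont : Continuous fun s => ⟪deriv X s, deriv X x₁⟫_ℝ := hXc.inner continuous_const
  have hftc : ∫ s in x₂..x₁, ⟪deriv X s, deriv X x₁⟫_ℝ = ⟪X x₁, deriv X x₁⟫_ℝ - ⟪X x₂, deriv X x₁⟫_ℝ :=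
    intervalIntegral.integral_eq_sub_of_hasDerivAt (fun s _ => hg s) (hcont.intervalIntegrable _ _)
  have hlow : ∀ s, 1 - Rb ^ 2 / 2 ≤ ⟪deriv X s, deriv X x₁⟫_ℝ := fun s => inner_unit_ge (hXu s) (hXu x₁) (hosc s x₁)
  have hmono := intervalIntegral.integral_mono_on (μ := volume) hx (intervalIntegrable_const (c := 1 - Rb ^ 2 / 2))
    (hcont.intervalIntegrable _ _) (fun s _ => hlow s)
  rw [intervalIntegral.integral_const, smul_eq_mul, hftc] at hmono
  rw [inner_sub_left]
  linarith

/-- Coordinate form of `chord_proj_ge'`. [folklore] -/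
theorem chord_proj_coords_ge' {X : ℝ → EuclideanSpace ℝ (Fin 3)} (hX : ContDiff ℝ 1 X) (hXu : ∀ τ, ‖deriv X τ‖ = 1)
    {Rb : ℝ} (hosc : ∀ τ σ, ‖deriv X τ - deriv X σ‖ ≤ Rb) {x₁ x₂ : ℝ} (hx : x₂ ≤ x₁) :
    (1 - Rb ^ 2 / 2) * (x₁ - x₂) ≤ ∑ i, (⟪X x₁, EuclideanSpace.single i (1:ℝ)⟫_ℝ - ⟪X x₂, EuclideanSpace.single i (1:ℝ)⟫_ℝ) *
      ⟪deriv X x₁, EuclideanSpace.single i (1:ℝ)⟫_ℝ := by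
  have h := chord_proj_ge' hX hXu hosc hx
  have hco : ⟪X x₁ - X x₂, deriv X x₁⟫_ℝ = ∑ i, (⟪X x₁, EuclideanSpace.single i (1:ℝ)⟫_ℝ - ⟪X x₂, EuclideanSpace.single i (1:ℝ)⟫_ℝ) *
      ⟪deriv X x₁, EuclideanSpace.single i (1:ℝ)⟫_ℝ := by
    simp only [inner_single_eq]
    rw [PiLp.inner_apply]
    refine Finset.sum_congr rfl fun i _ => ?_
    simp [mul_comm]
  rw [← hco]
  exact h

end Summit.NavierStokesRegularity.NavierStokesRegularity.Theorems.StadiumChordProjection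

end
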